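import Literature.NumberTheory.Automorphic.UnitaryGroupAutomorphicRep
import Literature.NumberTheory.Automorphic.AsaiSign
import HarnessLib

/-!
# Mok's endoscopic classification for quasi-split unitary groups: weak base change (ascent) and
# standard base change of conjugate self-dual cuspidal representations (descent), a.e. Satake form

Topic `NumberTheory/Automorphic`; namespace `Literature.NumberTheory.Automorphic`. Cite/fact item
`wi-25070` (route `Langlands/TrigonalHeartLimit`; definite `U(4)` and `U(3,1)` over `ℚ` w.r.t.
`K = ℚ(ω)`), filed over the interface the definition files announce for exactly these facts:
"the named facts these notions are for (Mok 2014, Thm. 2.5.2 / Cor. 4.3.8: weak base change and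
descent for `U_{E/F}(N)`) — cite items of the planner; `IsWeakBaseChange` + `AsaiSign.HasAsaiSign` +
`CuspidalAutomorphicRepData` are the interface" (`UnitaryGroupAutomorphicRep.lean`, "What is NOT
here"), and AsaiSign.lean ("recorded only in docstrings … Mok's descent criterion").  TWO NAMED FACTS
(D-0014), nothing defined, nothing proved.

**Setting** (Mok, Mem. AMS 235 no. 1108 (2015) = arXiv:1206.0882, §1 Notation, §2.3–2.5, §4.3):
`E/F` a quadratic extension of number fields with non-trivial automorphism `c` (hypotheses
`Module.finrank F E = 2`, `c ≠ 1`, as in `Mok2014_partialAsaiL_pole_dichotomy`), `N ≥ 1`,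
`U_{E/F}(N)` the quasi-split unitary group of the anti-diagonal Hermitian form
(`UnitaryGroup.quasiSplitDatum`), its automorphic representation data
`UnitaryGroupAutomorphicRep F E c N hcpt` and cuspidal ones `UnitaryGroup.CuspidalAutomorphicRepData`,
the automorphic representation data `AutomorphicRepData (AutomorphyDatum.gl N E hcpt)` of
`GL_N(𝔸_E)` with the cuspidal ones `CuspidalAutomorphicRepData N E hcpt` (`AutomorphicRepsGL`), and
the a.e. Satake interface: `UnitaryGroup.IsWeakBaseChange P π` ("`Π` (= `P`) is a weak base change
of `π`": at all but finitely many finite places `w` of `E` the Satake parameters of `P` at `w` are the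
STANDARD base-change Satake parameters `ξ_1(c(π))` of `π`, Mok §2.1 (2.1.9), §4.3),
`AutomorphicRepData.IsConjSelfDualAE P c` (`Π^c ≅ Π^∨` a.e. on Satake parameters) and
`AutomorphicRepData.HasAsaiSign Π c κ` (the partial Asai `L`-function `L^S(s, Π, As^{(−1)^{N−1}κ})` has a
pole at `s = 1`, AsaiSign.lean).

## Sources, as printed (read: `lit read arxiv:1206.0882`)

* §2.3 (arXiv pp. 10–11): `Ψ_sim(N) = {μ ⊠ ν}` (`μ` unitary cuspidal on `GL_m(𝔸_E)`, `ν` the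
  `n`-dimensional representation of `SL₂(ℂ)`, `N = mn`; "`ψ^N = μ ⊠ ν` corresponds to an irreducible
  unitary representation `π_{ψ^N}` of `GL_N(𝔸_E)` that belongs to the discrete automorphic spectrum"
  [Mœglin–Waldspurger]); `Ψ(N)` = formal sums `ψ^N = l₁ψ₁^{N₁} ⊞ ⋯ ⊞ l_rψ_r^{N_r}`,
  `π_{ψ^N} = 𝓘_P(⋯)` "which is irreducible … The association `ψ^N ↔ π_{ψ^N}` is then a bijection between
  the full `L²` automorphic spectrum of `GL_N(𝔸_E)` and `Ψ(N)`" (Langlands, Mœglin–Waldspurger);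
  `μ^* := (μ^c)^∨`, "`μ` is conjugate self-dual if `μ^* = μ`"; `Ψ̃(N) ⊆ Ψ(N)` the conjugate self-dual
  formal parameters (`(ψ_i)^* = ψ_{i^*}`, `l_i = l_{i^*}` for an involution of the index set);
  "`Φ̃_sim(N)` of conjugate self-dual simple generic parameters, namely those given by a conjugate
  self-dual cuspidal automorphic representation on `GL_N(𝔸_E)`"; Hecke eigenfamilies `c(π)`, `c(ψ^N)`
  (Jacquet–Shalika).
* **Thm. 2.4.2** (the "seed theorem", p. 13): "Suppose that `φ^N ∈ Φ̃_sim(N)` is a conjugate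
  self-dual simple generic global parameter. Then there exists a unique (up to equivalence) twisted
  endoscopic data `(G, ξ_{χ_κ}) ∈ Ẽ_ell(N)`, such that `c(φ^N) = ξ_{χ_κ}(c(π))` for some representation
  `π` in the discrete automorphic spectrum of `G(𝔸_F)`. Furthermore, `(G, ξ_{χ_κ})` is in fact
  simple, thus of the form `(U_{E/F}(N), ξ_{χ_κ})` for a unique `κ ∈ {±1}`" ("we can just take
  `χ_+ = 1`", p. 13: `ξ_{χ_+} = ξ_1` is the standard base change `L`-embedding).
* **Thm. 2.5.4 (a)** (p. 20): for such `φ^N` with sign `κ`, "the Asai `L`-function `L(s, φ^N, As^η)`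
  has a pole at `s = 1`, where `η = (−1)^{N−1}·κ`"; preceding paragraph: exactly one of
  `L(s, φ^N, As^±)` has a pole at `s = 1`, a simple one; **Remark 2.5.5** (p. 21): "given a unitary
  cuspidal automorphic representation `Π` of `GL_N(𝔸_E)` that is conjugate self-dual, we have `Π`
  arises as "standard base change" from `U_{E/F}(N)` if and only if `L(s, Π, As^{(−1)^{N−1}})` has a
  pole at `s = 1` (with a similar result for the "twisted base change")".
* **Cor. 4.3.8** (p. 52; `G = U_{E/F}(N)`, `ξ : ᴸU_{E/F}(N) ↪ ᴸG_{E/F}(N)`):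
  "`L²_disc(G(F)∖G(𝔸)) = ⊕_{ψ^N ∈ Ψ̃(N)} L²_{disc,ψ^N,ξ}(G(F)∖G(𝔸))`" (`L²_{disc,ψ^N,ξ}` the part with
  Hecke eigenfamily `ξ(c) = c(ψ^N)`), and p. 53: "corollary 4.3.8 gives in particular the existence of
  "weak base change" associated to discrete automorphic representations on `U_{E/F}(N)` (with respect
  to the `L`-embedding `ξ`)".
* **Thm. 2.5.2** (p. 20): `L²_disc(U_{E/F}(N)(F)∖U_{E/F}(N)(𝔸_F)) = ⊕_{ψ ∈ Ψ₂(U(N), ξ_{χ_κ})} ⊕_{π ∈ Π_ψ(ε_ψ)} π`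
  (the full endoscopic classification; not restated here).

## What is vendored (weaker than printed, in the a.e. Satake interface)

* `Mok2014_weakBaseChange` — **ascent** (Cor. 4.3.8 + p. 53 + §2.3): every CUSPIDAL automorphic
  representation datum `π` of `U_{E/F}(N)(𝔸_F)` (cuspidal ⊆ discrete: the centre `U(1)_{E/F}` is
  anisotropic) has a weak base change `P`, an automorphic representation datum of `GL_N(𝔸_E)`
  (the `π_{ψ^N}` of the parameter `ψ^N ∈ Ψ̃(N)` carrying `π`, an element of the `L²` automorphic
  spectrum of `GL_N(𝔸_E)` by §2.3) which is conjugate self-dual a.e. (`ψ^N ∈ Ψ̃(N)`: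
  `c(ψ^N)_{c w} = (c(ψ^N)_w)^∨`).  The finer printed structure (`P` an isobaric sum of the
  `π_{μ_i ⊠ ν_i}` with the conjugate self-dual involution on the index set; `Ψ₂`, packets,
  multiplicities of Thm. 2.5.2) is NOT restated — the item's "isobaric sum of conjugate self-dual
  cuspidal representations" is only correct for generic elliptic parameters and is not asserted.
* `Mok2014_standardBaseChange_descent` — **descent** (Thm. 2.4.2 with Thm. 2.5.4 (a) / Remark 2.5.5):
  a conjugate self-dual cuspidal automorphic representation datum `Π` of `GL_N(𝔸_E)` whose Asai
  `L`-function `L^S(s, Π, As^{(−1)^{N−1}})` has a pole at `s = 1` (`HasAsaiSign Π c 1`, i.e. Mok's sign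
  `κ(Π) = +1`) is the STANDARD weak base change of some automorphic representation datum `π` of
  `U_{E/F}(N)` (printed: of a `π` in the discrete automorphic spectrum; "discrete" is not restated —
  weaker).  The twisted case `κ = −1` (base change w.r.t. `ξ_{χ_−}`) and the "only if" direction
  are not restated.  **Mis-stated in its antecedent** (provefact verdict 2026-08-16, see the
  section "Discrepancy" below): the statement is kept byte-for-byte for its users; the corrected
  statement lives, proved equivalent to it modulo the missing analytic ingredient, in the accepted
  companion `MokStandardBaseChangeDescentContinuation.lean`.

## Discrepancy in `Mok2014_standardBaseChange_descent` (recorded 2026-08-16; statement unchanged)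

The first version of this docstring justified the hypothesis `HasAsaiSign Π c 1` by "the printed
criterion is for the completed Asai `L`-function; the tree's `HasAsaiSign` is its partial (Satake)
form, which differs by finitely many local factors holomorphic and non-zero at `s = 1` (Flicker
1988, Theorem p. 297; Shahidi 1981 Thm. 5.1), so the hypothesis used here implies the printed
one".  That addresses *partial versus complete*, which is indeed harmless, but not *raw product
versus continuation*, which is not.  `HasAsaiSign Π c 1 = HasAsaiPole Π c ((-1)^(N+1))`
(AsaiSign.lean) asks, for every Asai datum `(S, A)` of `Π`, that the **raw** partial Euler product
`partialAsaiL S c A ((-1)^(N+1)) s` — an unconditional `tprod`, junk value `1` off its domain of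
multipliability — satisfy `(s - 1) L^S(s) → r ≠ 0` as `s → 1` inside `{1 < Re s}`.  Mok's
`L(s, Π, As^±)` (Thm. 2.5.4 (a), Remark 2.5.5; likewise the hypothesis of the automorphic descent of
Ginzburg–Rallis–Soudry) are the Langlands–Shahidi Asai `L`-functions, the **meromorphic
continuation** of an Euler product absolutely convergent only "in some right half-plane
`Re(s) > C`" (Grbac–Shahidi 2015, §2.A; Flicker 1988, Theorem p. 297: "converges absolutely,
uniformly in compact subsets, in some right half-plane. It has meromorphic continuation …").  For
`N ≥ 3` neither implication between "raw pole at `1⁺`" and "pole of the continuation at `1`" is a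
published theorem: either amounts to the holomorphy of the raw partial Asai product on
`1 < Re s ≤ C` (Jacquet–Shalika's bounds over `E` give `Re s > 3/2` only, by Cauchy–Schwarz at the
inert places where `q_w = q_v²`; `Re s > 1` would follow from the Ramanujan conjecture for `Π` or
from the automorphy of the Asai transfer to `GL_{N²}(𝔸_F)`, known for `N ≤ 2`) — the same
unpublished ingredient for which `Mok2014_partialAsaiL_pole_dichotomy` was deprecated (AsaiSign.lean,
`AsaiSignContinuation.lean`).  Hence, as typed, the fact is **incomparable** with the printed
theorem — given a raw pole at `As^{(−1)^{N−1}}`, Mok's Thm. 2.4.2 (descent with a unique sign `κ`)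
and §2.5 (exactly one continued `L(s, Π, As^±)` has a pole at `1`) do not exclude `κ(Π) = −1` with a
raw `As^{(−1)^{N−1}}`-product misbehaving on `1 < Re s ≤ C` — and it cannot be discharged from
[Mok2014]; nor is it weaker than print.  (Underneath, in either currency, the theorem is Mok's
"seed theorem" 2.4.2, "proved by induction and comparison of trace formulas … the complete proof
will only be achieved at the end of section nine", p. 13 — not an inline proof.)

**Corrected statement** `D'` (continuation currency; same binders and conclusion, hypothesis
`HasAsaiSign Π c 1` replaced by: for every Asai datum `(S, A)` of `Π` there is `σ₀ ≥ 1` with the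
partial `As^{(−1)^{N−1}}` Euler product multipliable on `Re s > σ₀` and a function `G` holomorphic
on `{1/2 < Re s}`, `G(s) = (s - 1) L^S(s, Π, As^{(−1)^{N−1}})` for `Re s > σ₀`, `G(1) ≠ 0` — verbatim
clause (ii) of the corrected dichotomy, hypothesis `h` of
`Mok2014_partialAsaiL_pole_dichotomy_of_continuation`): it is the right-hand side of the accepted
`Mok2014_standardBaseChange_descent_iff_continuation` (`MokStandardBaseChangeDescentContinuation.lean`),
which proves `Mok2014_standardBaseChange_descent ↔ D'` given the corrected dichotomy and the
holomorphy of the raw partial Asai products on `{1 < Re s}`; the pointwise bridges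
`AutomorphicRepData.hasAsaiPole_of_continuation` /
`AutomorphicRepData.HasAsaiPole.false_of_holomorphic_continuation` and their unconditional tempered
forms (`…_of_norm_le_one`: Satake parameters of norm `≤ 1` make the raw product holomorphic and
non-zero on `{1 < Re s}`, `differentiableOn_partialAsaiL_of_norm_le_one`) convert between the two
currencies for a single `Π`, and `Mok2014_standardBaseChange_descent.exists_isWeakBaseChange_of_continuation`
is the route-usable form with the PRINTED hypothesis for tempered `Π`.  `D'` is not declared as a
named fact here (a provefact seat may not mint one, D-0026); deprecating the present `def` and
vendoring `D'` — or re-basing `HasAsaiPole` on the continuation form, which would repair this fact,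
`FakhruddinPilloni2021_thm_9_6` and every other consumer of `HasAsaiSign` at once — is left to the
verdict clean-up (`audit:p67843`), as was done for `Mok2014_partialAsaiL_pole_dichotomy`.

Design: closed named facts quantifying over `F E : Type` (all data live in `Type`, like
`AdelicGroupData.{0}`), `[E : F] = 2`, `c ≠ 1`, `0 < N`, `hcpt`, exactly in the shape of
`Mok2014_partialAsaiL_pole_dichotomy`; `open scoped Classical` for the place subtypes of the unitary
datum (design note (H5) of `UnitaryGroupAutomorphicRep.lean`).  KMSW (inner forms) is out of scope.
-/

noncomputable section

open scoped Classical

namespace Literature.NumberTheory.Automorphic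

/-- **Mok (2015), Cor. 4.3.8 — weak base change from `U_{E/F}(N)` to `GL_N(𝔸_E)` (ascent), a.e.
Satake form.**  Printed: "`L²_disc(G(F)∖G(𝔸)) = ⊕_{ψ^N ∈ Ψ̃(N)} L²_{disc,ψ^N,ξ}(G(F)∖G(𝔸))`" for
`G = U_{E/F}(N)` and the standard `L`-embedding `ξ`, which "gives in particular the existence of
"weak base change" associated to discrete automorphic representations on `U_{E/F}(N)`" (p. 53),
the parameter `ψ^N ∈ Ψ̃(N)` being conjugate self-dual and carried by the automorphic representation
`π_{ψ^N}` of `GL_N(𝔸_E)` (§2.3).  Vendored, weaker: for `E/F` quadratic with non-trivial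
automorphism `c`, `N ≥ 1`, every cuspidal automorphic representation datum `π` of
`U_{E/F}(N)(𝔸_F)` admits an automorphic representation datum `P` of `GL_N(𝔸_E)`, conjugate
self-dual almost everywhere on Satake parameters (`IsConjSelfDualAE`), which is a weak base change
of `π`: at all but finitely many finite places `w` of `E` the Satake parameters of `P` at `w` are
the standard base-change Satake parameters of `π` (`UnitaryGroup.IsWeakBaseChange`).  Named fact
(D-0014); users take `(h : Mok2014_weakBaseChange)`.
[cite: Mok2014, Cor. 4.3.8 and the paragraph following it (arXiv pp. 52–53), Prop. 4.3.4, §2.3 (arXiv pp. 10–11)] -/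
def Mok2014_weakBaseChange : Prop :=
  ∀ (F E : Type) [Field F] [NumberField F] [Field E] [NumberField E] [Algebra F E] (c : E ≃ₐ[F] E),
    Module.finrank F E = 2 → c ≠ 1 →
    ∀ (N : ℕ) (hcpt : isCompact_glFiniteIntegralLevel N E)
      (π : UnitaryGroup.CuspidalAutomorphicRepData F E c N hcpt), 0 < N →
      ∃ P : AutomorphicRepData (AutomorphyDatum.gl N E hcpt),
        P.IsConjSelfDualAE c ∧ UnitaryGroup.IsWeakBaseChange F E c N hcpt P π.1

/-- **Mok (2015), Thm. 2.4.2 with Thm. 2.5.4 (a) — descent of conjugate self-dual cuspidal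
representations of `GL_N(𝔸_E)` with standard Asai sign to `U_{E/F}(N)`, a.e. Satake form.**
Printed: Thm. 2.4.2: for a conjugate self-dual simple generic global parameter
`φ^N ∈ Φ̃_sim(N)` — i.e. a conjugate self-dual cuspidal automorphic representation of `GL_N(𝔸_E)` —
"there exists a unique … `(G, ξ_{χ_κ})` … such that `c(φ^N) = ξ_{χ_κ}(c(π))` for some representation
`π` in the discrete automorphic spectrum of `G(𝔸_F)` … of the form `(U_{E/F}(N), ξ_{χ_κ})` for a
unique `κ ∈ {±1}`"; Thm. 2.5.4 (a): "`L(s, φ^N, As^η)` has a pole at `s = 1`, where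
`η = (−1)^{N−1}·κ`" (and exactly one of `As^±` has a pole); Remark 2.5.5: "`Π` arises as "standard
base change" from `U_{E/F}(N)` if and only if `L(s, Π, As^{(−1)^{N−1}})` has a pole at `s = 1`".
Vendored, weaker (the direction "if", standard case `κ = +1`, `χ_+ = 1`): for `E/F` quadratic with
non-trivial automorphism `c`, `N ≥ 1`, every cuspidal automorphic representation datum `Π` of
`GL_N(𝔸_E)` which is conjugate self-dual a.e. (`IsConjSelfDualAE`) and has Asai sign `+1`
(`HasAsaiSign Π c 1`: the partial Asai `L`-function `L^S(s, Π, As^{(−1)^{N−1}})` has a pole at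
`s = 1` for every Asai datum — the partial form of the printed criterion, AsaiSign.lean) is a weak
base change (`UnitaryGroup.IsWeakBaseChange`, standard `ξ_1`) of some automorphic representation
datum `π` of `U_{E/F}(N)(𝔸_F)`.  Named fact (D-0014); users take
`(h : Mok2014_standardBaseChange_descent)`.

**Mis-stated in its antecedent (provefact verdict 2026-08-16; statement kept byte-for-byte for its
users).**  `HasAsaiSign Π c 1` is a pole at `1⁺` of the RAW partial Asai Euler product (`tprod`,
junk value `1`), whereas the printed hypothesis is a pole of the meromorphically CONTINUED
Langlands–Shahidi `L(s, Π, As^{(−1)^{N−1}})` (product absolutely convergent only for `Re(s) > C`,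
Grbac–Shahidi 2015 §2.A, Flicker 1988 Thm. p. 297); for `N ≥ 3` neither implication is in print
(holomorphy of the raw product on `1 < Re s ≤ C` is Ramanujan-strength), so this statement is
neither derivable from [Mok2014] nor weaker than it — see the module docstring, "Discrepancy".
Corrected statement (continuation currency) = the right-hand side of
`Mok2014_standardBaseChange_descent_iff_continuation`
(`MokStandardBaseChangeDescentContinuation.lean`, with the tempered bridges); deprecation /
re-basing of `HasAsaiPole` is left to the verdict clean-up (`audit:p67843`).
[cite: Mok2014, Thm. 2.4.2 (arXiv p. 13), Thm. 2.5.4 (a) and Remark 2.5.5 (arXiv pp. 20–21) — "if" direction, misrendered for the raw partial Euler product at 1⁺; corrected statement = RHS of Mok2014_standardBaseChange_descent_iff_continuation]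
[cite: Flicker1988, Theorem p. 297 (partial versus complete Asai L-function; convergence "in some right half-plane" only)] -/
def Mok2014_standardBaseChange_descent : Prop :=
  ∀ (F E : Type) [Field F] [NumberField F] [Field E] [NumberField E] [Algebra F E] (c : E ≃ₐ[F] E),
    Module.finrank F E = 2 → c ≠ 1 →
    ∀ (N : ℕ) (hcpt : isCompact_glFiniteIntegralLevel N E) (P : CuspidalAutomorphicRepData N E hcpt),
      0 < N → P.1.IsConjSelfDualAE c → P.1.HasAsaiSign c 1 →
      ∃ π : UnitaryGroupAutomorphicRep F E c N hcpt, UnitaryGroup.IsWeakBaseChange F E c N hcpt P.1 π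

end Literature.NumberTheory.Automorphic
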